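import Summits.ValiantsHypothesis.ValiantsHypothesis.Theorems.LacunarySymmetroidMatrixDescartesDoorA26WallBubblingMixThreeStage

/-!
# Wall bubbling for `DoorA26` — THE REPAIRED THREE-SCALE MIXED-CLASS RULE OVER ABSTRACT FRAMES (for the three-pair chain)

HONEST FRAMING.  Obligation (W) `stub_weylFaces` of `Cruxes/DoorA26/Lines/wall_bubbling.lean` (crux `DoorA26`, stmt-ValiantsHypothesis-19979; OPEN,
typed, never asserted); W1 seat val-sym-door-p2 g14.  W1 #60 `mixThree_face'` (= `MixThree26'` of rev 9) is stated on the TWO-PAIR frames (the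
if-chains with special positions `0,1,4,5`).  The remaining chain hypothesis `ValueGenericThreePairChain26` of (W_deepVal) needs the SAME rule for
each of the three mixed classes `δ₀+δ₁`, `δ₀+δ₂`, `δ₁+δ₂` of the THREE-PAIR frame (special positions `0..5`).  Since the one-stage lemma W1 #59
`mixThree_stage` never reads the frame at positions `2, 3`, the rule holds for ANY frames `F₁, F₂, F₃ : ℕ → Fin 6 → M₂(ℝ)` whose entries at the
positions `0, 5, 1, 4` are the two-dslope letters of `U` at the scales `0`, `L₁`, `L₁+L₂` — whatever they are elsewhere:

* **`mixThree_frames`** — `(hF₁0 : ∀ ν, F₁ ν 0 = U ν 0 + U ν 5) … (hF₃4 : ∀ ν, F₃ ν 4 = (δs ν 4 − δs ν 1) • (e^{δs ν 4 (L₁+L₂)} • U ν 4))`,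
  dominations / Gram-normalised limits stated for `polar (Fᵢ ν a) (Fᵢ ν b)`, conclusion
  `(Γ₁ 0 4 ≠ 0 ∨ Γ₁ 5 1 ≠ 0) → (Γ₂ 0 4 ≠ 0 ∨ Γ₂ 5 1 ≠ 0) → (Γ₃ 0 4 ≠ 0 ∨ Γ₃ 5 1 ≠ 0) → False` (symmetric letters, `δ0 0 ≠ δ0 1`).

The three-pair instances are then one `simp` of the frame equations each, after relabelling the letters (`U ∘ σ`, `δs ∘ σ`) so that the class
sits at positions `(0,5),(1,4)` (port memo `HOME/val-sym-door-p2/g14/THREE-PAIR-CHAIN-PORT.md`).  Proof = W1 #60's with the if-chain evaluations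
replaced by the frame equations.  Registers unchanged; (W), `ValueGenericThreePairChain26`, `DoorA26` 19979, 18050 OPEN; nothing on VP ≠ VNP.
Def-free.  `--supports stmt-ValiantsHypothesis-19979 --as helper`.
-/

-- `Summit.ValiantsHypothesis.ValiantsHypothesis.…` repeats a component by the D-0017 layout
-- (single-conjunct summit), which the `dupNamespace` linter flags; the name is mandated.
set_option linter.dupNamespace false

namespace Summit.ValiantsHypothesis.ValiantsHypothesis.Theorems.LacunarySymmetroidMatrixDescartes.WallBubbling

open Finset Filter Topology
open Bubbling (polar)
open scoped BigOperators

/-- **THE REPAIRED THREE-SCALE RULE OVER ABSTRACT FRAMES** (see the module docstring): symmetric letters, value-generic face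
(`δ0 5 = δ0 0`, `δ0 4 = δ0 1`, `δ0 0 ≠ δ0 1`), frames prescribed at positions `0,5,1,4` only. [this work] -/
theorem mixThree_frames (δ0 : Fin 6 → ℝ) (h50 : δ0 5 = δ0 0) (h41 : δ0 4 = δ0 1) (h01 : δ0 0 ≠ δ0 1)
    (δs : ℕ → Fin 6 → ℝ) (hδ : ∀ l, Tendsto (fun ν => δs ν l) atTop (𝓝 (δ0 l)))
    (U : ℕ → Fin 6 → Matrix (Fin 2) (Fin 2) ℝ) (hU : ∀ ν l, (U ν l).IsSymm)
    (F₁ F₂ F₃ : ℕ → Fin 6 → Matrix (Fin 2) (Fin 2) ℝ) (L₁ L₂ : ℕ → ℝ) (hL₁ : Tendsto L₁ atTop atTop) (hL₂ : Tendsto L₂ atTop atTop)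
    (hF₁0 : ∀ ν, F₁ ν 0 = U ν 0 + U ν 5) (hF₁5 : ∀ ν, F₁ ν 5 = (δs ν 5 - δs ν 0) • U ν 5)
    (hF₁1 : ∀ ν, F₁ ν 1 = U ν 1 + U ν 4) (hF₁4 : ∀ ν, F₁ ν 4 = (δs ν 4 - δs ν 1) • U ν 4)
    (hF₂0 : ∀ ν, F₂ ν 0 = Real.exp (δs ν 0 * L₁ ν) • U ν 0 + Real.exp (δs ν 5 * L₁ ν) • U ν 5)
    (hF₂5 : ∀ ν, F₂ ν 5 = (δs ν 5 - δs ν 0) • (Real.exp (δs ν 5 * L₁ ν) • U ν 5))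
    (hF₂1 : ∀ ν, F₂ ν 1 = Real.exp (δs ν 1 * L₁ ν) • U ν 1 + Real.exp (δs ν 4 * L₁ ν) • U ν 4)
    (hF₂4 : ∀ ν, F₂ ν 4 = (δs ν 4 - δs ν 1) • (Real.exp (δs ν 4 * L₁ ν) • U ν 4))
    (hF₃0 : ∀ ν, F₃ ν 0 = Real.exp (δs ν 0 * (L₁ ν + L₂ ν)) • U ν 0 + Real.exp (δs ν 5 * (L₁ ν + L₂ ν)) • U ν 5)
    (hF₃5 : ∀ ν, F₃ ν 5 = (δs ν 5 - δs ν 0) • (Real.exp (δs ν 5 * (L₁ ν + L₂ ν)) • U ν 5))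
    (hF₃1 : ∀ ν, F₃ ν 1 = Real.exp (δs ν 1 * (L₁ ν + L₂ ν)) • U ν 1 + Real.exp (δs ν 4 * (L₁ ν + L₂ ν)) • U ν 4)
    (hF₃4 : ∀ ν, F₃ ν 4 = (δs ν 4 - δs ν 1) • (Real.exp (δs ν 4 * (L₁ ν + L₂ ν)) • U ν 4))
    (μ₁ μ₂ μ₃ : ℕ → ℝ) (hμ₁ : ∀ ν, 0 < μ₁ ν) (hμ₂ : ∀ ν, 0 < μ₂ ν) (hμ₃ : ∀ ν, 0 < μ₃ ν)
    (hdom₁ : ∀ ν a b, |polar (F₁ ν a) (F₁ ν b)| ≤ μ₁ ν) (hdom₂ : ∀ ν a b, |polar (F₂ ν a) (F₂ ν b)| ≤ μ₂ ν)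
    (hdom₃ : ∀ ν a b, |polar (F₃ ν a) (F₃ ν b)| ≤ μ₃ ν)
    (Γ₁ Γ₂ Γ₃ : Fin 6 → Fin 6 → ℝ)
    (hΓ₁ : ∀ a b, Tendsto (fun ν => polar (F₁ ν a) (F₁ ν b) / μ₁ ν) atTop (𝓝 (Γ₁ a b)))
    (hΓ₂ : ∀ a b, Tendsto (fun ν => polar (F₂ ν a) (F₂ ν b) / μ₂ ν) atTop (𝓝 (Γ₂ a b)))
    (hΓ₃ : ∀ a b, Tendsto (fun ν => polar (F₃ ν a) (F₃ ν b) / μ₃ ν) atTop (𝓝 (Γ₃ a b))) :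
    (Γ₁ 0 4 ≠ 0 ∨ Γ₁ 5 1 ≠ 0) → (Γ₂ 0 4 ≠ 0 ∨ Γ₂ 5 1 ≠ 0) → (Γ₃ 0 4 ≠ 0 ∨ Γ₃ 5 1 ≠ 0) → False := by
  intro h1 h2 h3
  have hw0 : Tendsto (fun ν => δs ν 5 - δs ν 0) atTop (𝓝 0) := by
    have := (hδ 5).sub (hδ 0)
    rw [h50, sub_self] at this
    exact this
  have hw1 : Tendsto (fun ν => δs ν 4 - δs ν 1) atTop (𝓝 0) := by
    have := (hδ 4).sub (hδ 1)
    rw [h41, sub_self] at this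
    exact this
  have hL₃ : Tendsto (fun ν => L₁ ν + L₂ ν) atTop atTop := hL₁.atTop_add_atTop hL₂
  -- the Gram-normalised limits are bounded by one
  have hB₁ : ∀ a b, |Γ₁ a b| ≤ 1 := fun a b => by
    refine le_of_tendsto' (hΓ₁ a b).abs fun ν => ?_
    rw [abs_div, abs_of_pos (hμ₁ ν)]
    exact (div_le_one (hμ₁ ν)).mpr (hdom₁ ν a b)
  have hB₂ : ∀ a b, |Γ₂ a b| ≤ 1 := fun a b => by
    refine le_of_tendsto' (hΓ₂ a b).abs fun ν => ?_
    rw [abs_div, abs_of_pos (hμ₂ ν)]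
    exact (div_le_one (hμ₂ ν)).mpr (hdom₂ ν a b)
  have hB₃ : ∀ a b, |Γ₃ a b| ≤ 1 := fun a b => by
    refine le_of_tendsto' (hΓ₃ a b).abs fun ν => ?_
    rw [abs_div, abs_of_pos (hμ₃ ν)]
    exact (div_le_one (hμ₃ ν)).mpr (hdom₃ ν a b)
  -- the levels `κᵢ` of the alive members at the three scales
  obtain ⟨κ₁, hκ₁, hκ₁1, e1⟩ : ∃ κ : ℝ, 0 < κ ∧ κ ≤ 1 ∧ ∀ᶠ ν in atTop,
      (κ * μ₁ ν ≤ |polar (U ν 0 + U ν 5) ((δs ν 4 - δs ν 1) • U ν 4)| ∨ κ * μ₁ ν ≤ |polar ((δs ν 5 - δs ν 0) • U ν 5) (U ν 1 + U ν 4)|) := by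
    rcases h1 with h | h
    · refine ⟨|Γ₁ 0 4| / 2, half_pos (abs_pos.mpr h), by linarith [hB₁ 0 4], ?_⟩
      have t := ((hΓ₁ 0 4).abs).eventually_const_lt (show |Γ₁ 0 4| / 2 < |Γ₁ 0 4| by linarith [abs_pos.mpr h])
      filter_upwards [t] with ν hν
      left
      rw [hF₁0 ν, hF₁4 ν] at hν
      rw [abs_div, abs_of_pos (hμ₁ ν), lt_div_iff₀ (hμ₁ ν)] at hν
      exact hν.le
    · refine ⟨|Γ₁ 5 1| / 2, half_pos (abs_pos.mpr h), by linarith [hB₁ 5 1], ?_⟩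
      have t := ((hΓ₁ 5 1).abs).eventually_const_lt (show |Γ₁ 5 1| / 2 < |Γ₁ 5 1| by linarith [abs_pos.mpr h])
      filter_upwards [t] with ν hν
      right
      rw [hF₁5 ν, hF₁1 ν] at hν
      rw [abs_div, abs_of_pos (hμ₁ ν), lt_div_iff₀ (hμ₁ ν)] at hν
      exact hν.le
  obtain ⟨κ₂, hκ₂, hκ₂1, e2⟩ : ∃ κ : ℝ, 0 < κ ∧ κ ≤ 1 ∧ ∀ᶠ ν in atTop,
      (κ * μ₂ ν ≤ |polar (Real.exp (δs ν 0 * L₁ ν) • U ν 0 + Real.exp (δs ν 5 * L₁ ν) • U ν 5)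
        ((δs ν 4 - δs ν 1) • (Real.exp (δs ν 4 * L₁ ν) • U ν 4))| ∨
       κ * μ₂ ν ≤ |polar ((δs ν 5 - δs ν 0) • (Real.exp (δs ν 5 * L₁ ν) • U ν 5))
        (Real.exp (δs ν 1 * L₁ ν) • U ν 1 + Real.exp (δs ν 4 * L₁ ν) • U ν 4)|) := by
    rcases h2 with h | h
    · refine ⟨|Γ₂ 0 4| / 2, half_pos (abs_pos.mpr h), by linarith [hB₂ 0 4], ?_⟩
      have t := ((hΓ₂ 0 4).abs).eventually_const_lt (show |Γ₂ 0 4| / 2 < |Γ₂ 0 4| by linarith [abs_pos.mpr h])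
      filter_upwards [t] with ν hν
      left
      rw [hF₂0 ν, hF₂4 ν] at hν
      rw [abs_div, abs_of_pos (hμ₂ ν), lt_div_iff₀ (hμ₂ ν)] at hν
      exact hν.le
    · refine ⟨|Γ₂ 5 1| / 2, half_pos (abs_pos.mpr h), by linarith [hB₂ 5 1], ?_⟩
      have t := ((hΓ₂ 5 1).abs).eventually_const_lt (show |Γ₂ 5 1| / 2 < |Γ₂ 5 1| by linarith [abs_pos.mpr h])
      filter_upwards [t] with ν hν
      right
      rw [hF₂5 ν, hF₂1 ν] at hν
      rw [abs_div, abs_of_pos (hμ₂ ν), lt_div_iff₀ (hμ₂ ν)] at hν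
      exact hν.le
  obtain ⟨κ₃, hκ₃, hκ₃1, e3⟩ : ∃ κ : ℝ, 0 < κ ∧ κ ≤ 1 ∧ ∀ᶠ ν in atTop,
      (κ * μ₃ ν ≤ |polar (Real.exp (δs ν 0 * (L₁ ν + L₂ ν)) • U ν 0 + Real.exp (δs ν 5 * (L₁ ν + L₂ ν)) • U ν 5)
        ((δs ν 4 - δs ν 1) • (Real.exp (δs ν 4 * (L₁ ν + L₂ ν)) • U ν 4))| ∨
       κ * μ₃ ν ≤ |polar ((δs ν 5 - δs ν 0) • (Real.exp (δs ν 5 * (L₁ ν + L₂ ν)) • U ν 5))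
        (Real.exp (δs ν 1 * (L₁ ν + L₂ ν)) • U ν 1 + Real.exp (δs ν 4 * (L₁ ν + L₂ ν)) • U ν 4)|) := by
    rcases h3 with h | h
    · refine ⟨|Γ₃ 0 4| / 2, half_pos (abs_pos.mpr h), by linarith [hB₃ 0 4], ?_⟩
      have t := ((hΓ₃ 0 4).abs).eventually_const_lt (show |Γ₃ 0 4| / 2 < |Γ₃ 0 4| by linarith [abs_pos.mpr h])
      filter_upwards [t] with ν hν
      left
      rw [hF₃0 ν, hF₃4 ν] at hν
      rw [abs_div, abs_of_pos (hμ₃ ν), lt_div_iff₀ (hμ₃ ν)] at hν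
      exact hν.le
    · refine ⟨|Γ₃ 5 1| / 2, half_pos (abs_pos.mpr h), by linarith [hB₃ 5 1], ?_⟩
      have t := ((hΓ₃ 5 1).abs).eventually_const_lt (show |Γ₃ 5 1| / 2 < |Γ₃ 5 1| by linarith [abs_pos.mpr h])
      filter_upwards [t] with ν hν
      right
      rw [hF₃5 ν, hF₃1 ν] at hν
      rw [abs_div, abs_of_pos (hμ₃ ν), lt_div_iff₀ (hμ₃ ν)] at hν
      exact hν.le
  -- growth of the transvection coefficients (W2's `eventually_dslope_exp_gt`)
  have gΛ₂ := eventually_dslope_exp_gt (fun ν => δs ν 5 - δs ν 0) L₁ hw0 hL₁ (1 / κ₂) (1 / κ₁ + 1) (by positivity) (by positivity)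
  have gΛ₃ := eventually_dslope_exp_gt (fun ν => δs ν 5 - δs ν 0) (fun ν => L₁ ν + L₂ ν) hw0 hL₃ (1 / κ₃) (1 / κ₁ + 1)
    (by positivity) (by positivity)
  have gΛ₂' := eventually_dslope_exp_gt (fun ν => δs ν 4 - δs ν 1) L₁ hw1 hL₁ (1 / κ₂) (1 / κ₁ + 1) (by positivity) (by positivity)
  have gΛ₃' := eventually_dslope_exp_gt (fun ν => δs ν 4 - δs ν 1) (fun ν => L₁ ν + L₂ ν) hw1 hL₃ (1 / κ₃) (1 / κ₁ + 1)
    (by positivity) (by positivity)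
  have gΛL := eventually_dslope_exp_gt (fun ν => δs ν 5 - δs ν 0) L₂ hw0 hL₂ (1 / κ₃) (1 / κ₂ + 1) (by positivity) (by positivity)
  have gΛL' := eventually_dslope_exp_gt (fun ν => δs ν 4 - δs ν 1) L₂ hw1 hL₂ (1 / κ₃) (1 / κ₂ + 1) (by positivity) (by positivity)
  -- sizes and the kill
  have eL₁ : ∀ᶠ ν in atTop, 1 ≤ L₁ ν := hL₁.eventually_ge_atTop 1
  have eL₂ : ∀ᶠ ν in atTop, 0 ≤ L₂ ν := hL₂.eventually_ge_atTop 0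
  set c : ℝ := |δ0 0 - δ0 1| / 2 with hc
  have hcpos : 0 < c := by rw [hc]; exact half_pos (abs_pos.mpr (sub_ne_zero.mpr h01))
  have hgap : Tendsto (fun ν => |δs ν 0 - δs ν 1|) atTop (𝓝 (2 * c)) := by
    have := ((hδ 0).sub (hδ 1)).abs
    rw [show |δ0 0 - δ0 1| = 2 * c by rw [hc]; ring] at this
    exact this
  have ea : ∀ᶠ ν in atTop, -|δs ν 0 - δs ν 1| ≤ -c := by
    have t := hgap.eventually_const_lt (show c < 2 * c by linarith)
    filter_upwards [t] with ν hν
    linarith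
  have eb : ∀ᶠ ν in atTop, |δs ν 5 - δs ν 0| + |δs ν 4 - δs ν 1| ≤ c / 36 := by
    have t : Tendsto (fun ν => |δs ν 5 - δs ν 0| + |δs ν 4 - δs ν 1|) atTop (𝓝 0) := by
      have := hw0.abs.add hw1.abs
      simpa using this
    exact (t.eventually (Iic_mem_nhds (by positivity))).mono fun ν h => h
  have eK := eventually_kill (fun ν => L₁ ν + L₂ ν) (fun ν => -|δs ν 0 - δs ν 1|) (fun ν => |δs ν 5 - δs ν 0| + |δs ν 4 - δs ν 1|)
    hL₃ c hcpos ea eb (κ₁ ^ 4 * κ₂ ^ 2 * κ₃ ^ 3) (by positivity)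
  have eNe : ∀ᶠ ν in atTop, δs ν 0 ≠ δs ν 1 := by
    filter_upwards [ea] with ν hν
    intro h
    rw [h, sub_self, abs_zero, neg_zero] at hν
    linarith
  have hfalse : ∀ᶠ ν : ℕ in atTop, False := by
    filter_upwards [e1, e2, e3, gΛ₂, gΛ₃, gΛ₂', gΛ₃', gΛL, gΛL', eL₁, eL₂, eK, eNe]
      with ν hν1 hν2 hν3 q2 q3 q2' q3' qL qL' hl1 hl2 hK hne
    have b00 := hdom₁ ν 0 0
    rw [hF₁0 ν] at b00
    have b05 := hdom₁ ν 0 5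
    rw [hF₁0 ν, hF₁5 ν] at b05
    have b55 := hdom₁ ν 5 5
    rw [hF₁5 ν] at b55
    have b11 := hdom₁ ν 1 1
    rw [hF₁1 ν] at b11
    have b14 := hdom₁ ν 1 4
    rw [hF₁1 ν, hF₁4 ν] at b14
    have b44 := hdom₁ ν 4 4
    rw [hF₁4 ν] at b44
    have b01 := hdom₁ ν 0 1
    rw [hF₁0 ν, hF₁1 ν] at b01
    have b04 := hdom₁ ν 0 4
    rw [hF₁0 ν, hF₁4 ν] at b04
    have b51 := hdom₁ ν 5 1
    rw [hF₁5 ν, hF₁1 ν] at b51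
    have b54 := hdom₁ ν 5 4
    rw [hF₁5 ν, hF₁4 ν] at b54
    have d01₂ := hdom₂ ν 0 1
    rw [hF₂0 ν, hF₂1 ν] at d01₂
    have d04₂ := hdom₂ ν 0 4
    rw [hF₂0 ν, hF₂4 ν] at d04₂
    have d51₂ := hdom₂ ν 5 1
    rw [hF₂5 ν, hF₂1 ν] at d51₂
    have d54₂ := hdom₂ ν 5 4
    rw [hF₂5 ν, hF₂4 ν] at d54₂
    have d00₃ := hdom₃ ν 0 0
    rw [hF₃0 ν] at d00₃
    have d05₃ := hdom₃ ν 0 5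
    rw [hF₃0 ν, hF₃5 ν] at d05₃
    have d55₃ := hdom₃ ν 5 5
    rw [hF₃5 ν] at d55₃
    have d11₃ := hdom₃ ν 1 1
    rw [hF₃1 ν] at d11₃
    have d14₃ := hdom₃ ν 1 4
    rw [hF₃1 ν, hF₃4 ν] at d14₃
    have d44₃ := hdom₃ ν 4 4
    rw [hF₃4 ν] at d44₃
    have d01₃ := hdom₃ ν 0 1
    rw [hF₃0 ν, hF₃1 ν] at d01₃
    have d04₃ := hdom₃ ν 0 4
    rw [hF₃0 ν, hF₃4 ν] at d04₃
    have d51₃ := hdom₃ ν 5 1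
    rw [hF₃5 ν, hF₃1 ν] at d51₃
    have d54₃ := hdom₃ ν 5 4
    rw [hF₃5 ν, hF₃4 ν] at d54₃
    -- the size bounds at the two later scales
    have hl3 : 1 ≤ L₁ ν + L₂ ν := by linarith
    have hΦ₂ := frameSize_le (δs ν 5 - δs ν 0) (δs ν 4 - δs ν 1) (L₁ ν) (L₁ ν + L₂ ν) (by linarith) (by linarith) hl3
    have hΦ₃ := frameSize_le (δs ν 5 - δs ν 0) (δs ν 4 - δs ν 1) (L₁ ν + L₂ ν) (L₁ ν + L₂ ν) (by linarith) le_rfl hl3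
    exact mixThree_stage (δs ν) (U ν) (hU ν) hne (L₁ ν) (L₂ ν) (μ₁ ν) (μ₂ ν) (μ₃ ν) κ₁ κ₂ κ₃ _ (hμ₁ ν) hκ₁ hκ₂ hκ₃ hκ₁1 hκ₂1 hκ₃1
      b00 b05 b55 b11 b14 b44 b01 b04 b51 b54 hν1 d01₂ d04₂ d51₂ d54₂ hν2 d00₃ d05₃ d55₃ d11₃ d14₃ d44₃ d01₃ d04₃ d51₃ d54₃ hν3
      hΦ₂ hΦ₃ q2 q3 q2' q3' qL qL' hK
  exact hfalse.exists.elim fun _ h => h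

end Summit.ValiantsHypothesis.ValiantsHypothesis.Theorems.LacunarySymmetroidMatrixDescartes.WallBubbling
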